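import Summits.NavierStokesRegularity.OSWSelfSimilar.OSWAprioriWindow
import HarnessLib

/-!
# OSW separable blow-up, THEOREM E2 — the origin side sharpened: a degenerate zero at the origin forces `a < 1/3`,
# so every profile with `a ≥ 1/3` (all certified rungs) has a simple zero and `Hf(0) = 1/(1 − a)`

HONEST FRAMING (cells pub-oswblow / ns-blowup; 1-D MODEL (gCLM/OSW on the circle), computer-assisted context; not Euler/NS).

`OSWAprioriWindow.lean` proves, for the typed target of `SeparableBlowup.lean`, `1/P < a < 1`, the antipode identity
`(1 − a·P)·Hf(π) = 1`, and the origin identity `(1 − a)·Hf(0) = 1` UNDER the simple-zero hypothesis `f′(0) ≠ 0`. Here the origin side is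
closed: the logarithmic order `m = lim_{x→0⁺} x f′(x)/f(x)` (which exists by (T1), `= (H₀ − 1)/(a H₀)`) satisfies `a·m = 1 − 1/H₀ < 1`; if
`f′(0) = 0` then, `f` being odd and `C³` (so `f(0) = f′(0) = f″(0) = 0` and `|f| ≤ (sup|f‴|/6)·x³`), the growth lemma gives `m ≥ 3`, hence
`a < 1/3` (`lt_third_of_deriv_zero_eq_zero`) — the kernel form of the sentence «a degenerate zero at the origin (`m ≥ 3`) could only exist for
`a < 1/3`» of `OkamotoSakajoWunsch2008/AprioriBounds.lean`. Consequently `a ≥ 1/3 ⇒ f′(0) ≠ 0` and the ORIGIN IDENTITY HOLDS WITH NO EXTRA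
HYPOTHESIS for `a ≥ 1/3` (`origin_identity_of_third_le`), in particular for `P = 3` outright (`1/3 < a` by E2) and for every typed rung whose
window starts above `1/3` (`identities_of_analyticSeparableProfile`): both endpoint values `Hf(0) = 1/(1 − a)`, `Hf(π) = −1/(aP − 1)` of a
certified profile are determined by `a` and `P` alone. Tools: `le_of_tendsto_logDeriv_of_le_rpow` (order ≥ k from `F ≤ L·y^k`, generalising
`one_le_of_tendsto_logDeriv`) and the fencing lemma `image_norm_le_of_norm_deriv_right_le_deriv_boundary`. No definition, no named fact;
MODEL statements about a typed, unasserted target.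
-/

noncomputable section

namespace Summit.NavierStokesRegularity.OSWSelfSimilar
namespace OSWAprioriWindow

open _root_.MeasureTheory _root_.Set _root_.Filter
open Literature.Analysis.Fourier Literature.Analysis.FluidPDE.OkamotoSakajoWunsch2008
open scoped Real Topology

/-- A property holding eventually in `𝓝[>] 0` holds on some interval `(0, ε)` (helper). [folklore] -/
private theorem exists_Ioo_of_eventually' {p : ℝ → Prop} (h : ∀ᶠ y in 𝓝[>] (0 : ℝ), p y) :
    ∃ ε > 0, ∀ y ∈ Ioo 0 ε, p y := by
  rcases (mem_nhdsGT_iff_exists_Ioo_subset).mp h with ⟨ε, hε, hsub⟩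
  exact ⟨ε, hε, fun y hy => hsub hy⟩

/-- **Order at least `k`.** If `F > 0` on `(0, δ)` is differentiable there, `F(y) ≤ L·y^k`, and the logarithmic order `y·F′(y)/F(y)`
has a limit `m` as `y → 0⁺`, then `m ≥ k` (generalises `one_le_of_tendsto_logDeriv`). [folklore] -/
theorem le_of_tendsto_logDeriv_of_le_rpow {F F' : ℝ → ℝ} {δ m L k : ℝ} (hδ : 0 < δ)
    (hF : ∀ y ∈ Ioo 0 δ, HasDerivAt F (F' y) y) (hpos : ∀ y ∈ Ioo 0 δ, 0 < F y)
    (hlin : ∀ y ∈ Ioo 0 δ, F y ≤ L * y ^ k)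
    (hm : Tendsto (fun y => y * F' y / F y) (𝓝[>] 0) (𝓝 m)) : k ≤ m := by
  by_contra hmk'
  have hmk : m < k := not_le.mp hmk'
  set q : ℝ := (m + k) / 2 with hq_def
  have hmq : m < q := by rw [hq_def]; linarith
  have hqk : q < k := by rw [hq_def]; linarith
  obtain ⟨ε, hε, hεq⟩ := exists_Ioo_of_eventually' (hm.eventually (Iio_mem_nhds hmq))
  set δ' : ℝ := min δ ε with hδ'_def
  have hδ' : 0 < δ' := lt_min hδ hε
  have hsub : ∀ y ∈ Ioo 0 δ', y ∈ Ioo 0 δ := fun y hy => ⟨hy.1, lt_of_lt_of_le hy.2 (min_le_left _ _)⟩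
  have hsub' : ∀ y ∈ Ioo 0 δ', y ∈ Ioo 0 ε := fun y hy => ⟨hy.1, lt_of_lt_of_le hy.2 (min_le_right _ _)⟩
  have hanti : AntitoneOn (fun y => F y / y ^ q) (Ioo 0 δ') :=
    antitoneOn_div_rpow (fun y hy => hF y (hsub y hy)) (fun y hy => hpos y (hsub y hy))
      (fun y hy => le_of_lt (hεq y (hsub' y hy)))
  set y₀ : ℝ := δ' / 2 with hy₀_def
  have hy₀ : y₀ ∈ Ioo 0 δ' := ⟨by rw [hy₀_def]; linarith, by rw [hy₀_def]; linarith⟩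
  set C : ℝ := F y₀ / y₀ ^ q with hC_def
  have hC : 0 < C := div_pos (hpos y₀ (hsub y₀ hy₀)) (Real.rpow_pos_of_pos hy₀.1 q)
  have hbound : ∀ y ∈ Ioo 0 y₀, C ≤ L * y ^ (k - q) := by
    intro y hy
    have hy' : y ∈ Ioo 0 δ' := ⟨hy.1, lt_trans hy.2 hy₀.2⟩
    have h1 : C ≤ F y / y ^ q := hanti hy' hy₀ hy.2.le
    have hyq : 0 < y ^ q := Real.rpow_pos_of_pos hy.1 q
    have h2 : F y / y ^ q ≤ L * y ^ k / y ^ q := div_le_div_of_nonneg_right (hlin y (hsub y hy')) hyq.le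
    have h3 : L * y ^ k / y ^ q = L * y ^ (k - q) := by
      rw [Real.rpow_sub hy.1, mul_div_assoc]
    linarith [h3 ▸ h2]
  have hlim : Tendsto (fun y : ℝ => L * y ^ (k - q)) (𝓝[>] 0) (𝓝 0) := by
    have h1 : Tendsto (fun y : ℝ => y ^ (k - q)) (𝓝[>] 0) (𝓝 0) := by
      have hc : ContinuousAt (fun y : ℝ => y ^ (k - q)) 0 :=
        Real.continuousAt_rpow_const 0 (k - q) (Or.inr (by linarith))
      have := hc.tendsto
      rw [Real.zero_rpow (by linarith)] at this
      exact this.mono_left nhdsWithin_le_nhds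
    simpa using h1.const_mul L
  have hev : ∀ᶠ y in 𝓝[>] (0 : ℝ), L * y ^ (k - q) < C ∧ y ∈ Ioo 0 y₀ :=
    (hlim.eventually (Iio_mem_nhds hC)).and (Ioo_mem_nhdsGT hy₀.1)
  obtain ⟨y, hy1, hy2⟩ := hev.exists
  exact absurd (hbound y hy2) (not_le.mpr hy1)

/-- `ω` odd ⇒ `ω_xx` odd on the coefficient side. [folklore] -/
private theorem isOddSeq_derivCoeff_derivCoeff {c : ℤ → ℂ} (hodd : IsOddSeq c) : IsOddSeq (derivCoeff (derivCoeff c)) := by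
  intro k
  simp only [derivCoeff, hodd k]
  push_cast
  ring

/-- **`C³` flatness at a degenerate odd zero.** For an exponentially decaying odd coefficient sequence with `f′(0) = 0`
(`f = Re ∘ fourierEval c`), `|f(x)| ≤ (L₃/6)·x³` on `[0, ∞)`, where `L₃ = Σ_k ‖(derivCoeff³ c)_k‖` bounds `|f‴|`. [folklore] -/
theorem abs_le_cube_of_deriv_zero_eq_zero {c : ℤ → ℂ} {ρ K : ℝ} (hdec : ExpDecay c ρ K) (hodd : IsOddSeq c)
    (h0 : (fourierEval (derivCoeff c) 0).re = 0) {x : ℝ} (hx : 0 ≤ x) :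
    |(fourierEval c x).re| ≤ (∑' k, ‖derivCoeff (derivCoeff (derivCoeff c)) k‖) / 6 * x ^ 3 := by
  set L₃ : ℝ := ∑' k, ‖derivCoeff (derivCoeff (derivCoeff c)) k‖ with hL₃_def
  -- the three derivatives as real functions
  have hd1 := expDecay_derivCoeff hdec
  have hd2 := expDecay_derivCoeff hd1
  have hd3 := expDecay_derivCoeff hd2
  have hf1 : ∀ y, HasDerivAt (fun y => (fourierEval c y).re) ((fourierEval (derivCoeff c) y).re) y :=
    fun y => hasDerivAt_fourierEval_re hdec y
  have hf2 : ∀ y, HasDerivAt (fun y => (fourierEval (derivCoeff c) y).re)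
      ((fourierEval (derivCoeff (derivCoeff c)) y).re) y := fun y => hasDerivAt_fourierEval_re hd1 y
  have hf3 : ∀ y, HasDerivAt (fun y => (fourierEval (derivCoeff (derivCoeff c)) y).re)
      ((fourierEval (derivCoeff (derivCoeff (derivCoeff c))) y).re) y := fun y => hasDerivAt_fourierEval_re hd2 y
  have hL3 : ∀ y, |(fourierEval (derivCoeff (derivCoeff (derivCoeff c))) y).re| ≤ L₃ := fun y =>
    (Complex.abs_re_le_norm _).trans (norm_fourierEval_le hd3.summable_norm y)
  have h2zero : (fourierEval (derivCoeff (derivCoeff c)) 0).re = 0 := by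
    have h := fourierEval_neg_of_isOddSeq (isOddSeq_derivCoeff_derivCoeff hodd) 0
    rw [neg_zero] at h
    have : fourierEval (derivCoeff (derivCoeff c)) 0 = 0 := by
      have h2 : (2 : ℂ) * fourierEval (derivCoeff (derivCoeff c)) 0 = 0 := by linear_combination h
      simpa using h2
    simp [this]
  have h0zero : (fourierEval c 0).re = 0 := by
    have h := fourierEval_neg_of_isOddSeq hodd 0
    rw [neg_zero] at h
    have : fourierEval c 0 = 0 := by
      have h2 : (2 : ℂ) * fourierEval c 0 = 0 := by linear_combination h
      simpa using h2
    simp [this]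
  -- fence `f″`, then `f′`, then `f` on `[0, x]`
  have step2 : ∀ y ∈ Icc 0 x, ‖(fourierEval (derivCoeff (derivCoeff c)) y).re‖ ≤ L₃ * y := by
    refine image_norm_le_of_norm_deriv_right_le_deriv_boundary (f' := fun y => (fourierEval (derivCoeff (derivCoeff (derivCoeff c))) y).re)
      (fun y _ => (hf3 y).continuousAt.continuousWithinAt) (fun y _ => (hf3 y).hasDerivWithinAt) ?_
      (B := fun y => L₃ * y) (B' := fun _ => L₃) (fun y => by simpa using (hasDerivAt_id y).const_mul L₃) ?_
    · simp [h2zero]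
    · intro y _; rw [Real.norm_eq_abs]; exact hL3 y
  have step1 : ∀ y ∈ Icc 0 x, ‖(fourierEval (derivCoeff c) y).re‖ ≤ L₃ * y ^ 2 / 2 := by
    refine image_norm_le_of_norm_deriv_right_le_deriv_boundary (f' := fun y => (fourierEval (derivCoeff (derivCoeff c)) y).re)
      (fun y _ => (hf2 y).continuousAt.continuousWithinAt) (fun y _ => (hf2 y).hasDerivWithinAt) ?_
      (B := fun y => L₃ * y ^ 2 / 2) (B' := fun y => L₃ * y) (fun y => ?_) ?_
    · simp [h0]
    · have h1 : HasDerivAt (fun y : ℝ => y ^ 2) (2 * y) y := by simpa using hasDerivAt_pow 2 y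
      exact ((h1.const_mul L₃).div_const 2).congr_deriv (by ring)
    · intro y hy; exact step2 y (Ico_subset_Icc_self hy)
  have step0 : ∀ y ∈ Icc 0 x, ‖(fourierEval c y).re‖ ≤ L₃ * y ^ 3 / 6 := by
    refine image_norm_le_of_norm_deriv_right_le_deriv_boundary (f' := fun y => (fourierEval (derivCoeff c) y).re)
      (fun y _ => (hf1 y).continuousAt.continuousWithinAt) (fun y _ => (hf1 y).hasDerivWithinAt) ?_
      (B := fun y => L₃ * y ^ 3 / 6) (B' := fun y => L₃ * y ^ 2 / 2) (fun y => ?_) ?_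
    · simp [h0zero]
    · have h1 : HasDerivAt (fun y : ℝ => y ^ 3) (3 * y ^ 2) y := by simpa using hasDerivAt_pow 3 y
      exact ((h1.const_mul L₃).div_const 6).congr_deriv (by ring)
    · intro y hy; exact step1 y (Ico_subset_Icc_self hy)
  have := step0 x ⟨hx, le_rfl⟩
  rw [Real.norm_eq_abs] at this
  calc |(fourierEval c x).re| ≤ L₃ * x ^ 3 / 6 := this
    _ = L₃ / 6 * x ^ 3 := by ring

/-- **The origin order limit of a typed profile** (glue): under the hypotheses of `apriori_window`, `a ≠ 0`, `H₀ := Hf(0) > 0`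
(`H = hilbertTransformCircle`), and `x·f′(x)/f(x) → (H₀ − 1)/(a·H₀)` as `x → 0⁺`. [folklore] -/
theorem origin_logDeriv {a : ℝ} {c : ℤ → ℂ} {ρ K : ℝ} {P : ℕ} (hdec : ExpDecay c ρ K)
    (hre : IsRealSeq c) (hodd : IsOddSeq c) (hneg : ∀ x : ℝ, 0 < x → x < π → (fourierEval c x).re < 0)
    (hT1 : IsSeparableProfile a c) (hP : HasAntipodalOrder c P) :
    a ≠ 0 ∧ 0 < hilbertTransformCircle (fun y => (fourierEval c y).re) 0 ∧
      Tendsto (fun x => x * (fourierEval (derivCoeff c) x).re / (fourierEval c x).re) (𝓝[>] 0)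
        (𝓝 ((hilbertTransformCircle (fun y => (fourierEval c y).re) 0 - 1) /
          (a * hilbertTransformCircle (fun y => (fourierEval c y).re) 0))) := by
  set f : ℝ → ℝ := fun x => (fourierEval c x).re with hf_def
  set f' : ℝ → ℝ := fun x => (fourierEval (derivCoeff c) x).re with hf'_def
  set g : ℝ → ℝ := fun x => (velocityEval c x).re with hg_def
  set Hc : ℝ → ℝ := fun x => (fourierEval (hilbertCoeff c) x).re with hHc_def
  have hH : hilbertTransformCircle f = Hc := hilbertTransformCircle_fourierEval_re_eq hdec hre
  have hfd : ∀ x, HasDerivAt f (f' x) x := fun x => hasDerivAt_fourierEval_re hdec x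
  have hgd : ∀ x, HasDerivAt g (Hc x) x := by
    intro x
    have h := hasDerivAt_velocityEval_re hdec hre x
    rw [hilbertTransformCircle_fourierEval_re hdec hre x] at h
    exact h
  have hfc : Continuous f := Complex.continuous_re.comp (continuous_fourierEval hdec)
  have hHcc : Continuous Hc := Complex.continuous_re.comp (continuous_fourierEval (expDecay_hilbertCoeff hdec))
  have hEq : ∀ x, f x = -a * g x * f' x + f x * Hc x := by
    intro x
    have h := profileEq_re_of_isSeparableProfile hdec hre hT1 x
    rw [hilbertTransformCircle_fourierEval_re hdec hre x] at h
    exact h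
  have hfodd : ∀ x, f (-x) = -f x := fun x => by
    simp only [hf_def, fourierEval_neg_of_isOddSeq hodd, Complex.neg_re]
  have hgodd : ∀ x, g (-x) = -g x := fun x => by
    simp only [hg_def, velocityEval_neg_of_isOddSeq hodd, Complex.neg_re]
  have hf0 : f 0 = 0 := by have h := hfodd 0; rw [neg_zero] at h; linarith
  have hg0 : g 0 = 0 := by have h := hgodd 0; rw [neg_zero] at h; linarith
  have hneg' : ∀ y ∈ Ioo (0 : ℝ) π, f y < 0 := fun y hy => hneg y hy.1 hy.2
  -- `a ≠ 0` and `H₀ > 0` from the landed E2 package (`1/P < a`, `P ≥ 2` ⇒ `a > 0`)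
  obtain ⟨⟨haP, _⟩, _, hP2, _⟩ := apriori_window_and_antipode_identity hdec hre hodd hneg hT1 hP
  have hP0 : (0 : ℝ) < P := by exact_mod_cast lt_of_lt_of_le Nat.zero_lt_two hP2
  have hapos : 0 < a := lt_trans (div_pos one_pos hP0) haP
  have ha : a ≠ 0 := hapos.ne'
  -- `H₀ > 0` via the kernel sign (integrability from the `C¹` bound)
  set L : ℝ := ∑' k, ‖derivCoeff c k‖ with hL_def
  have hL : ∀ x, |f' x| ≤ L := fun x =>
    (Complex.abs_re_le_norm _).trans (norm_fourierEval_le (expDecay_derivCoeff hdec).summable_norm x)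
  have hb0 : ∀ y ∈ Icc (0 : ℝ) π, |f y| ≤ L * y := by
    intro y hy
    have := Convex.norm_image_sub_le_of_norm_hasDerivWithin_le (f := f) (f' := f') (s := univ)
      (fun z _ => (hfd z).hasDerivWithinAt) (fun z _ => by rw [Real.norm_eq_abs]; exact hL z) convex_univ
      (mem_univ 0) (mem_univ y)
    simp only [Real.norm_eq_abs, hf0, sub_zero] at this
    rwa [abs_of_nonneg hy.1] at this
  have hH0 : 0 < Hc 0 := by
    rw [← hH]; exact hilbertTransformCircle_zero_pos hfodd hneg' (intervalIntegrable_mul_cot_half hfc hb0)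
  have hg_slope : Tendsto (fun x => g x / x) (𝓝[>] 0) (𝓝 (Hc 0)) := by
    have h := (hgd 0).tendsto_slope_zero_right
    refine h.congr' ?_
    filter_upwards [self_mem_nhdsWithin] with x hx
    simp [hg0, div_eq_inv_mul]
  have hHc0 : Tendsto Hc (𝓝[>] 0) (𝓝 (Hc 0)) := hHcc.continuousAt.tendsto.mono_left nhdsWithin_le_nhds
  have hm : Tendsto (fun x => x * f' x / f x) (𝓝[>] 0) (𝓝 ((Hc 0 - 1) / (a * Hc 0))) :=
    tendsto_logDeriv_of_profileEq Real.pi_pos ha hH0.ne' (fun x _ => hEq x) (fun x hx => (hneg' x hx).ne)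
      hg_slope hHc0
  refine ⟨ha, ?_, ?_⟩
  · rw [hH]; exact hH0
  · rw [hH]; exact hm

/-- **A degenerate zero at the origin forces `a < 1/3`.** If the typed profile has `f′(0) = 0` then (odd, `C³` ⇒ order `m ≥ 3`;
`a·m = 1 − 1/H₀ < 1`) the parameter satisfies `a < 1/3`. [folklore] -/
theorem lt_third_of_deriv_zero_eq_zero {a : ℝ} {c : ℤ → ℂ} {ρ K : ℝ} {P : ℕ} (hdec : ExpDecay c ρ K)
    (hre : IsRealSeq c) (hodd : IsOddSeq c) (hneg : ∀ x : ℝ, 0 < x → x < π → (fourierEval c x).re < 0)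
    (hT1 : IsSeparableProfile a c) (hP : HasAntipodalOrder c P) (h0 : (fourierEval (derivCoeff c) 0).re = 0) :
    a < 1 / 3 := by
  obtain ⟨ha, hH0, hm⟩ := origin_logDeriv hdec hre hodd hneg hT1 hP
  set H₀ : ℝ := hilbertTransformCircle (fun y => (fourierEval c y).re) 0 with hH₀_def
  set L₃ : ℝ := ∑' k, ‖derivCoeff (derivCoeff (derivCoeff c)) k‖ with hL₃_def
  -- order ≥ 3 for `F = −f`
  have hm3 : (3 : ℝ) ≤ (H₀ - 1) / (a * H₀) := by
    refine le_of_tendsto_logDeriv_of_le_rpow (F := fun y => -(fourierEval c y).re)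
      (F' := fun y => -(fourierEval (derivCoeff c) y).re) (L := L₃ / 6) (k := 3) Real.pi_pos
      (fun y _ => (hasDerivAt_fourierEval_re hdec y).neg) (fun y hy => by simpa using hneg y hy.1 hy.2)
      (fun y hy => ?_) ?_
    · have h1 := abs_le_cube_of_deriv_zero_eq_zero hdec hodd h0 hy.1.le
      have h2 : -(fourierEval c y).re ≤ |(fourierEval c y).re| := neg_le_abs _
      have h3 : (y : ℝ) ^ (3 : ℝ) = y ^ (3 : ℕ) := by
        rw [show (3 : ℝ) = ((3 : ℕ) : ℝ) by norm_num, Real.rpow_natCast]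
      rw [h3]
      linarith
    · refine hm.congr' ?_
      filter_upwards [Ioo_mem_nhdsGT Real.pi_pos] with y hy
      have hfy : (fourierEval c y).re ≠ 0 := (hneg y hy.1 hy.2).ne
      field_simp
  -- `a·m = 1 − 1/H₀ < 1` and `a > 0` (from `1/P < a`)
  obtain ⟨⟨haP, _⟩, _, hP2, _⟩ := apriori_window_and_antipode_identity hdec hre hodd hneg hT1 hP
  have hP0 : (0 : ℝ) < P := by exact_mod_cast lt_of_lt_of_le Nat.zero_lt_two hP2
  have hapos : 0 < a := lt_trans (div_pos one_pos hP0) haP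
  have hprod : a * ((H₀ - 1) / (a * H₀)) = 1 - 1 / H₀ := by
    have : H₀ ≠ 0 := hH0.ne'
    field_simp
  have hlt : a * ((H₀ - 1) / (a * H₀)) < 1 := by
    rw [hprod]; have := one_div_pos.mpr hH0; linarith
  have h3a : 3 * a ≤ a * ((H₀ - 1) / (a * H₀)) := by nlinarith
  linarith

/-- **`a ≥ 1/3` ⇒ simple zero at the origin.** [folklore] -/
theorem deriv_zero_ne_zero_of_third_le {a : ℝ} {c : ℤ → ℂ} {ρ K : ℝ} {P : ℕ} (hdec : ExpDecay c ρ K)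
    (hre : IsRealSeq c) (hodd : IsOddSeq c) (hneg : ∀ x : ℝ, 0 < x → x < π → (fourierEval c x).re < 0)
    (hT1 : IsSeparableProfile a c) (hP : HasAntipodalOrder c P) (ha : 1 / 3 ≤ a) :
    (fourierEval (derivCoeff c) 0).re ≠ 0 := fun h0 =>
  absurd (lt_third_of_deriv_zero_eq_zero hdec hre hodd hneg hT1 hP h0) (not_lt.mpr ha)

/-- **Origin identity without the simple-zero hypothesis, for `a ≥ 1/3`:** `(1 − a)·Hf(0) = 1`, i.e. `Hf(0) = 1/(1 − a)`
(`H = hilbertTransformCircle`). [folklore] -/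
theorem origin_identity_of_third_le {a : ℝ} {c : ℤ → ℂ} {ρ K : ℝ} {P : ℕ} (hdec : ExpDecay c ρ K)
    (hre : IsRealSeq c) (hodd : IsOddSeq c) (hneg : ∀ x : ℝ, 0 < x → x < π → (fourierEval c x).re < 0)
    (hT1 : IsSeparableProfile a c) (hP : HasAntipodalOrder c P) (ha : 1 / 3 ≤ a) :
    (1 - a) * hilbertTransformCircle (fun y => (fourierEval c y).re) 0 = 1 :=
  origin_identity_of_simple_zero hdec hre hodd hneg hT1 hP (deriv_zero_ne_zero_of_third_le hdec hre hodd hneg hT1 hP ha)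

/-- **Both endpoint identities for the `P = 3` target, unconditionally** (`1/3 < a` is E2 itself):
`(1 − a)·Hf(0) = 1` and `(1 − 3a)·Hf(π) = 1`. [folklore] -/
theorem identities_three {a : ℝ} {c : ℤ → ℂ} {ρ K : ℝ} (hdec : ExpDecay c ρ K)
    (hre : IsRealSeq c) (hodd : IsOddSeq c) (hneg : ∀ x : ℝ, 0 < x → x < π → (fourierEval c x).re < 0)
    (hT1 : IsSeparableProfile a c) (hP : HasAntipodalOrder c 3) :
    (1 - a) * hilbertTransformCircle (fun y => (fourierEval c y).re) 0 = 1 ∧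
      (1 - a * 3) * hilbertTransformCircle (fun y => (fourierEval c y).re) π = 1 := by
  obtain ⟨⟨haP, _⟩, hanti, _, _⟩ := apriori_window_and_antipode_identity hdec hre hodd hneg hT1 hP
  refine ⟨origin_identity_of_third_le hdec hre hodd hneg hT1 hP ?_, by exact_mod_cast hanti⟩
  have : (1 : ℝ) / ((3 : ℕ) : ℝ) = 1 / 3 := by norm_num
  rw [this] at haP
  exact haP.le

/-- **For the typed target with a window above `1/3`** (every rung of the certified ladder, `a*_P ≥ 0.70`): there is a parameter
`a ∈ [lo, hi]` and a profile for which BOTH endpoint values of the analytic Hilbert transform are determined by `a` and `P` alone,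
`(1 − a)·Hf(0) = 1` and `(1 − a·P)·Hf(π) = 1`. [folklore] -/
theorem identities_of_analyticSeparableProfile {P : ℕ} {lo hi : ℝ} (hA : AnalyticSeparableProfile P lo hi) (hlo : 1 / 3 ≤ lo) :
    ∃ a : ℝ, lo ≤ a ∧ a ≤ hi ∧ ∃ c : ℤ → ℂ, IsSeparableProfile a c ∧ HasAntipodalOrder c P ∧
      (1 - a) * hilbertTransformCircle (fun y => (fourierEval c y).re) 0 = 1 ∧
      (1 - a * P) * hilbertTransformCircle (fun y => (fourierEval c y).re) π = 1 := by
  obtain ⟨a, hlo', hhi, c, ρ, K, hdec, hre, hodd, hneg, hT1, hP⟩ := hA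
  exact ⟨a, hlo', hhi, c, hT1, hP, origin_identity_of_third_le hdec hre hodd hneg hT1 hP (le_trans hlo hlo'),
    antipode_identity hdec hre hodd hneg hT1 hP⟩

end OSWAprioriWindow
end Summit.NavierStokesRegularity.OSWSelfSimilar

end
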